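import Mathlib
import Literature.Analysis.FluidPDE.VectorCalculus
import Summits.NavierStokesRegularity.NavierStokesRegularity.Theorems.FilamentSkeletonRssClause13RStationDecay

/-!
# Clause 13-R, route (ii′) item (a): CONTINUITY IN THE STATION of the Biot–Savart pairing densities, and their integrability on the tangency balls
# (crux `Clause13RNearStraightL`, stmt-NavierStokesRegularity-23612; line `rate_bordered_split`, STUB R `stub_rateRow13RFlat`)

Route `FilamentSkeletonRss`, Variant A1R.  To integrate the pairwise adjoint identities (`…Clause13RPairwiseAdjoint`) over the ball `τ ∈ S_j` and use
linearity of `∫_{S_j}`, each pairing density must be integrable on `S_j`.  This file proves, along a proper `C¹` axis `X = X_k` (`‖X′‖ ≤ 1`,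
`c|σ| − C ≤ ‖Xσ‖`) with a continuous core `m` having a floor `m₀ > 0`:

* §1 `inv_le_uniform` — the far-field domination `(‖y − Xσ‖² + mσ)⁻¹ ≤ M_R (1 + σ²)⁻¹` UNIFORMLY over stations `‖y‖ ≤ R` (on the ball `S_j` one has
  `‖X_jτ‖ ≤ R_b√(Γ log Γ)` by definition);
* §2 **`continuousOn_integral_localAdj`** — the transposed local weight `τ ↦ ∫ [(−3K₅⟪φτ, X′σ × (yτ − Xσ)⟫)•(yτ − Xσ) + K₃•(φτ × X′σ)] dσ` is continuous
  on every set where the station `y` and the weight `φ` are continuous and bounded (dominated convergence with the bound of §1); hence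
  (`integrableOn_inner_localAdj`) the local pairing density `τ ↦ ⟪∫ L^⊤φ dσ, Y_jτ⟫` is integrable on a compact ball;
* §3 **`continuous_integral_of_compact_support`** — a jointly continuous two-variable integrand vanishing for `σ` outside a compact `K` has a continuous
  `σ`-integral (the nonlocal `Y`- and `Y′`-pieces, whose `σ`-support lies in `tsupport Y_k`), with the integrability corollary on compact sets.

Hand `leafhand-ns-filamentskeletonrs-10-g0` (LAND-ONLY); `--supports stmt-NavierStokesRegularity-23612` helper.  HONEST FRAMING: calculus at a HYPOTHETICAL
near-straight filament skeleton on the NEGATIVE side of a MODEL blow-up route; STUB R is NOT proved here and nothing in this file bears on Navier–Stokes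
regularity or blow-up.
-/

noncomputable section

open MeasureTheory Filter Topology Set
open scoped RealInnerProductSpace InnerProductSpace
open Literature.Analysis.FluidPDE
open Summit.NavierStokesRegularity.NavierStokesRegularity.Theorems.MatchedKernel (inv_le_of_mem_ball)
open Summit.NavierStokesRegularity.NavierStokesRegularity.Theorems.Clause13RStationDecay

namespace Summit.NavierStokesRegularity.NavierStokesRegularity.Theorems.Clause13RStationContinuity
set_option linter.dupNamespace false

/-! ## §1 Uniform far-field domination over bounded stations -/

/-- **Uniform domination**: for stations `‖y‖ ≤ R`, `(‖y − Xσ‖² + mσ)⁻¹ ≤ M_R (1 + σ²)⁻¹` with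
`M_R = (4m₀ + c² + 4(|C| + R + 1)²)/(c² m₀)`. [folklore] -/
theorem inv_le_uniform {X : ℝ → EuclideanSpace ℝ (Fin 3)} {m : ℝ → ℝ} {m₀ c C R : ℝ} (hm₀ : 0 < m₀) (hm : ∀ σ, m₀ ≤ m σ)
    (hc : 0 < c) (hXg : ∀ σ, c * |σ| - C ≤ ‖X σ‖) {y : EuclideanSpace ℝ (Fin 3)} (hy : ‖y‖ ≤ R) (σ : ℝ) :
    (‖y - X σ‖ ^ 2 + m σ)⁻¹ ≤ (4 * m₀ + c ^ 2 + 4 * (|C| + R + 1) ^ 2) / (c ^ 2 * m₀) * (1 + σ ^ 2)⁻¹ := by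
  have h := inv_le_of_mem_ball hm₀ hm hc hXg y (Metric.mem_ball_self one_pos) σ
  refine h.trans (mul_le_mul_of_nonneg_right ?_ (inv_nonneg.2 (by positivity)))
  refine div_le_div_of_nonneg_right ?_ (by positivity)
  have h1 : 0 ≤ |C| + ‖y‖ + 1 := by positivity
  have h2 : |C| + ‖y‖ + 1 ≤ |C| + R + 1 := by linarith
  nlinarith [mul_le_mul h2 h2 h1 (h1.trans h2)]

/-! ## §2 The transposed local weight is continuous in the station -/

/-- **Continuity in the station of the transposed local weight** `τ ↦ ∫ [(−3K₅⟪φτ, X′σ × (yτ − Xσ)⟫)•(yτ − Xσ) + K₃•(φτ × X′σ)] dσ` on any set `S` on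
which the (continuous) station `y` and weight `φ` are bounded: `‖yτ‖ ≤ R`, `‖φτ‖ ≤ Φ` (dominated convergence). [folklore] -/
theorem continuousOn_integral_localAdj {X y φ : ℝ → EuclideanSpace ℝ (Fin 3)} {m : ℝ → ℝ} {m₀ c C R Φ : ℝ} {S : Set ℝ}
    (hm₀ : 0 < m₀) (hm : ∀ σ, m₀ ≤ m σ) (hmc : Continuous m) (hc : 0 < c) (hX : ContDiff ℝ 1 X) (hX1 : ∀ σ, ‖deriv X σ‖ ≤ 1)
    (hXg : ∀ σ, c * |σ| - C ≤ ‖X σ‖) (hy : Continuous y) (hφ : Continuous φ) (hΦ : 0 ≤ Φ)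
    (hyS : ∀ τ ∈ S, ‖y τ‖ ≤ R) (hφS : ∀ τ ∈ S, ‖φ τ‖ ≤ Φ) :
    ContinuousOn (fun τ => ∫ σ, ((-3 * ((‖y τ - X σ‖ ^ 2 + m σ) ^ (5 / 2 : ℝ))⁻¹ * ⟪φ τ, cross (deriv X σ) (y τ - X σ)⟫) • (y τ - X σ)
        + ((‖y τ - X σ‖ ^ 2 + m σ) ^ (3 / 2 : ℝ))⁻¹ • cross (φ τ) (deriv X σ))) S := by
  have hXc : Continuous X := hX.continuous
  have hX'c : Continuous (deriv X) := hX.continuous_deriv le_rfl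
  have hmpos : ∀ σ, 0 < m σ := fun σ => hm₀.trans_le (hm σ)
  -- joint continuity of the integrand
  have hd2 : Continuous fun p : ℝ × ℝ => y p.1 - X p.2 := (hy.comp continuous_fst).sub (hXc.comp continuous_snd)
  have hs2 : Continuous fun p : ℝ × ℝ => ‖y p.1 - X p.2‖ ^ 2 + m p.2 := (hd2.norm.pow 2).add (hmc.comp continuous_snd)
  have hpos2 : ∀ p : ℝ × ℝ, 0 < ‖y p.1 - X p.2‖ ^ 2 + m p.2 := fun p => by have := hmpos p.2; positivity
  have hk52 : Continuous fun p : ℝ × ℝ => ((‖y p.1 - X p.2‖ ^ 2 + m p.2) ^ (5 / 2 : ℝ))⁻¹ :=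
    (hs2.rpow_const fun p => Or.inl (hpos2 p).ne').inv₀ fun p => (Real.rpow_pos_of_pos (hpos2 p) _).ne'
  have hk32 : Continuous fun p : ℝ × ℝ => ((‖y p.1 - X p.2‖ ^ 2 + m p.2) ^ (3 / 2 : ℝ))⁻¹ :=
    (hs2.rpow_const fun p => Or.inl (hpos2 p).ne').inv₀ fun p => (Real.rpow_pos_of_pos (hpos2 p) _).ne'
  have hcr2 : Continuous fun p : ℝ × ℝ => cross (deriv X p.2) (y p.1 - X p.2) :=
    (crossCLM.continuous.comp (hX'c.comp continuous_snd)).clm_apply hd2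
  have hcr3 : Continuous fun p : ℝ × ℝ => cross (φ p.1) (deriv X p.2) :=
    (crossCLM.continuous.comp (hφ.comp continuous_fst)).clm_apply (hX'c.comp continuous_snd)
  have hH : Continuous fun p : ℝ × ℝ =>
      (-3 * ((‖y p.1 - X p.2‖ ^ 2 + m p.2) ^ (5 / 2 : ℝ))⁻¹ * ⟪φ p.1, cross (deriv X p.2) (y p.1 - X p.2)⟫) • (y p.1 - X p.2)
        + ((‖y p.1 - X p.2‖ ^ 2 + m p.2) ^ (3 / 2 : ℝ))⁻¹ • cross (φ p.1) (deriv X p.2) :=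
    (((continuous_const.mul hk52).mul ((hφ.comp continuous_fst).inner hcr2)).smul hd2).add (hk32.smul hcr3)
  set M : ℝ := (4 * m₀ + c ^ 2 + 4 * (|C| + R + 1) ^ 2) / (c ^ 2 * m₀) with hM
  refine continuousOn_of_dominated (bound := fun σ => ((3 * Φ * (Real.sqrt m₀)⁻¹) * M + (Φ * (Real.sqrt m₀)⁻¹) * M) * (1 + σ ^ 2)⁻¹)
    (fun τ _ => (hH.comp (Continuous.prodMk_right τ)).aestronglyMeasurable) ?_ ?_ ?_
  · intro τ hτ
    refine Eventually.of_forall fun σ => ?_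
    have hu := inv_le_uniform hm₀ hm hc hXg (hyS τ hτ) σ
    have b1 := norm_kernel5_term_le' (d := y τ - X σ) (a := deriv X σ) (φ := φ τ) hm₀ (hm σ) (hX1 σ)
    have b2 := norm_kernel3_cross_le' (d := y τ - X σ) (a := deriv X σ) (φ := φ τ) hm₀ (hm σ) (hX1 σ)
    have hφτ := hφS τ hτ
    have hs0 : 0 ≤ (Real.sqrt m₀)⁻¹ := inv_nonneg.2 (Real.sqrt_nonneg _)
    calc ‖(-3 * ((‖y τ - X σ‖ ^ 2 + m σ) ^ (5 / 2 : ℝ))⁻¹ * ⟪φ τ, cross (deriv X σ) (y τ - X σ)⟫) • (y τ - X σ)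
            + ((‖y τ - X σ‖ ^ 2 + m σ) ^ (3 / 2 : ℝ))⁻¹ • cross (φ τ) (deriv X σ)‖
        ≤ (3 * ‖φ τ‖ * (Real.sqrt m₀)⁻¹) * (‖y τ - X σ‖ ^ 2 + m σ)⁻¹ + (‖φ τ‖ * (Real.sqrt m₀)⁻¹) * (‖y τ - X σ‖ ^ 2 + m σ)⁻¹ :=
          (norm_add_le _ _).trans (add_le_add b1 b2)
      _ ≤ (3 * Φ * (Real.sqrt m₀)⁻¹) * (M * (1 + σ ^ 2)⁻¹) + (Φ * (Real.sqrt m₀)⁻¹) * (M * (1 + σ ^ 2)⁻¹) := by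
          have hinv : 0 ≤ (‖y τ - X σ‖ ^ 2 + m σ)⁻¹ := inv_nonneg.2 (by have := hmpos σ; positivity)
          gcongr
      _ = _ := by ring
  · exact integrable_inv_one_add_sq.const_mul _
  · exact Eventually.of_forall fun σ => (hH.comp (Continuous.prodMk_left σ)).continuousOn

/-- … hence the local pairing density `τ ↦ ⟪∫ L^⊤φ dσ, Y τ⟫` is integrable on a compact set `S` on which `‖yτ‖ ≤ R` (for the ball `S_j`:
`R = R_b√(Γ log Γ)`), for continuous `Y`. [folklore] -/
theorem integrableOn_inner_localAdj {X y φ Y : ℝ → EuclideanSpace ℝ (Fin 3)} {m : ℝ → ℝ} {m₀ c C R : ℝ} {S : Set ℝ} (hS : IsCompact S)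
    (hm₀ : 0 < m₀) (hm : ∀ σ, m₀ ≤ m σ) (hmc : Continuous m) (hc : 0 < c) (hX : ContDiff ℝ 1 X) (hX1 : ∀ σ, ‖deriv X σ‖ ≤ 1)
    (hXg : ∀ σ, c * |σ| - C ≤ ‖X σ‖) (hy : Continuous y) (hφ : Continuous φ) (hY : Continuous Y)
    (hyS : ∀ τ ∈ S, ‖y τ‖ ≤ R) :
    IntegrableOn (fun τ => ⟪∫ σ, ((-3 * ((‖y τ - X σ‖ ^ 2 + m σ) ^ (5 / 2 : ℝ))⁻¹ * ⟪φ τ, cross (deriv X σ) (y τ - X σ)⟫) • (y τ - X σ)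
        + ((‖y τ - X σ‖ ^ 2 + m σ) ^ (3 / 2 : ℝ))⁻¹ • cross (φ τ) (deriv X σ)), Y τ⟫) S := by
  obtain ⟨Φ, hΦ⟩ := hS.exists_bound_of_continuousOn hφ.continuousOn
  have hΦ0 : 0 ≤ max Φ 0 := le_max_right _ _
  have hcont := continuousOn_integral_localAdj hm₀ hm hmc hc hX hX1 hXg hy hφ hΦ0 hyS
    (fun τ hτ => (hΦ τ hτ).trans (le_max_left _ _))
  exact (hcont.inner hY.continuousOn).integrableOn_compact hS

/-! ## §3 Compactly supported two-variable integrands -/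

/-- A jointly continuous integrand vanishing for `σ` outside a compact `K` has a continuous `σ`-integral. [folklore] -/
theorem continuous_integral_of_compact_support {K : Set ℝ} (hK : IsCompact K) {F : ℝ → ℝ → EuclideanSpace ℝ (Fin 3)}
    (hF : Continuous (Function.uncurry F)) (hFK : ∀ τ σ, σ ∉ K → F τ σ = 0) :
    Continuous fun τ => ∫ σ, F τ σ := by
  have h : (fun τ => ∫ σ, F τ σ) = fun τ => ∫ σ in K, F τ σ := by
    funext τ
    exact (setIntegral_eq_integral_of_forall_compl_eq_zero fun σ hσ => hFK τ σ hσ).symm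
  rw [h]
  exact continuous_parametric_integral_of_continuous hF hK

/-- … and its pairing with a continuous field is integrable on every compact set. [folklore] -/
theorem integrableOn_inner_integral_of_compact_support {K S : Set ℝ} (hK : IsCompact K) (hS : IsCompact S)
    {F : ℝ → ℝ → EuclideanSpace ℝ (Fin 3)} (hF : Continuous (Function.uncurry F)) (hFK : ∀ τ σ, σ ∉ K → F τ σ = 0)
    {φ : ℝ → EuclideanSpace ℝ (Fin 3)} (hφ : Continuous φ) :
    IntegrableOn (fun τ => ⟪φ τ, ∫ σ, F τ σ⟫) S :=
  ((hφ.inner (continuous_integral_of_compact_support hK hF hFK)).continuousOn).integrableOn_compact hS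

/-- The nonlocal `Y`-piece of the variation kernel, as a two-variable integrand, is jointly continuous and vanishes off `tsupport Y`; hence its pairing
density is integrable on compact balls. [folklore] -/
theorem integrableOn_inner_integral_nonlocal {X y φ Y : ℝ → EuclideanSpace ℝ (Fin 3)} {m : ℝ → ℝ} {S : Set ℝ} (hS : IsCompact S)
    (hmc : Continuous m) (hmpos : ∀ σ, 0 < m σ) (hX : ContDiff ℝ 1 X) (hy : Continuous y) (hφ : Continuous φ)
    (hY : Continuous Y) (hYc : HasCompactSupport Y) :
    IntegrableOn (fun τ => ⟪φ τ, ∫ σ, ((3 * ⟪y τ - X σ, Y σ⟫ * ((‖y τ - X σ‖ ^ 2 + m σ) ^ (5 / 2 : ℝ))⁻¹) • cross (deriv X σ) (y τ - X σ)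
        - ((‖y τ - X σ‖ ^ 2 + m σ) ^ (3 / 2 : ℝ))⁻¹ • cross (deriv X σ) (Y σ))⟫) S := by
  have hXc : Continuous X := hX.continuous
  have hX'c : Continuous (deriv X) := hX.continuous_deriv le_rfl
  have hd2 : Continuous fun p : ℝ × ℝ => y p.1 - X p.2 := (hy.comp continuous_fst).sub (hXc.comp continuous_snd)
  have hs2 : Continuous fun p : ℝ × ℝ => ‖y p.1 - X p.2‖ ^ 2 + m p.2 := (hd2.norm.pow 2).add (hmc.comp continuous_snd)
  have hpos2 : ∀ p : ℝ × ℝ, 0 < ‖y p.1 - X p.2‖ ^ 2 + m p.2 := fun p => by have := hmpos p.2; positivity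
  have hk52 : Continuous fun p : ℝ × ℝ => ((‖y p.1 - X p.2‖ ^ 2 + m p.2) ^ (5 / 2 : ℝ))⁻¹ :=
    (hs2.rpow_const fun p => Or.inl (hpos2 p).ne').inv₀ fun p => (Real.rpow_pos_of_pos (hpos2 p) _).ne'
  have hk32 : Continuous fun p : ℝ × ℝ => ((‖y p.1 - X p.2‖ ^ 2 + m p.2) ^ (3 / 2 : ℝ))⁻¹ :=
    (hs2.rpow_const fun p => Or.inl (hpos2 p).ne').inv₀ fun p => (Real.rpow_pos_of_pos (hpos2 p) _).ne'
  have hcr2 : Continuous fun p : ℝ × ℝ => cross (deriv X p.2) (y p.1 - X p.2) :=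
    (crossCLM.continuous.comp (hX'c.comp continuous_snd)).clm_apply hd2
  have hcr3 : Continuous fun p : ℝ × ℝ => cross (deriv X p.2) (Y p.2) :=
    (crossCLM.continuous.comp (hX'c.comp continuous_snd)).clm_apply (hY.comp continuous_snd)
  have hF : Continuous (Function.uncurry fun τ σ =>
      (3 * ⟪y τ - X σ, Y σ⟫ * ((‖y τ - X σ‖ ^ 2 + m σ) ^ (5 / 2 : ℝ))⁻¹) • cross (deriv X σ) (y τ - X σ)
        - ((‖y τ - X σ‖ ^ 2 + m σ) ^ (3 / 2 : ℝ))⁻¹ • cross (deriv X σ) (Y σ)) :=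
    (((continuous_const.mul (hd2.inner (hY.comp continuous_snd))).mul hk52).smul hcr2).sub (hk32.smul hcr3)
  refine integrableOn_inner_integral_of_compact_support hYc hS hF (fun τ σ hσ => ?_) hφ
  show (3 * ⟪y τ - X σ, Y σ⟫ * ((‖y τ - X σ‖ ^ 2 + m σ) ^ (5 / 2 : ℝ))⁻¹) • cross (deriv X σ) (y τ - X σ)
        - ((‖y τ - X σ‖ ^ 2 + m σ) ^ (3 / 2 : ℝ))⁻¹ • cross (deriv X σ) (Y σ) = 0
  rw [image_eq_zero_of_notMem_tsupport hσ, inner_zero_right,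
      ← crossCLM_apply (deriv X σ) (0 : EuclideanSpace ℝ (Fin 3)), map_zero]
  simp

/-- The `Y′`-piece likewise (its `σ`-support lies in `tsupport Y′ ⊆ tsupport Y`). [folklore] -/
theorem integrableOn_inner_integral_derivTerm {X y φ Y : ℝ → EuclideanSpace ℝ (Fin 3)} {m : ℝ → ℝ} {S : Set ℝ} (hS : IsCompact S)
    (hmc : Continuous m) (hmpos : ∀ σ, 0 < m σ) (hX : ContDiff ℝ 1 X) (hy : Continuous y) (hφ : Continuous φ)
    (hY : ContDiff ℝ 1 Y) (hYc : HasCompactSupport Y) :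
    IntegrableOn (fun τ => ⟪φ τ, ∫ σ, ((‖y τ - X σ‖ ^ 2 + m σ) ^ (3 / 2 : ℝ))⁻¹ • cross (deriv Y σ) (y τ - X σ)⟫) S := by
  have hXc : Continuous X := hX.continuous
  have hY'c : Continuous (deriv Y) := hY.continuous_deriv le_rfl
  have hd2 : Continuous fun p : ℝ × ℝ => y p.1 - X p.2 := (hy.comp continuous_fst).sub (hXc.comp continuous_snd)
  have hs2 : Continuous fun p : ℝ × ℝ => ‖y p.1 - X p.2‖ ^ 2 + m p.2 := (hd2.norm.pow 2).add (hmc.comp continuous_snd)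
  have hpos2 : ∀ p : ℝ × ℝ, 0 < ‖y p.1 - X p.2‖ ^ 2 + m p.2 := fun p => by have := hmpos p.2; positivity
  have hk32 : Continuous fun p : ℝ × ℝ => ((‖y p.1 - X p.2‖ ^ 2 + m p.2) ^ (3 / 2 : ℝ))⁻¹ :=
    (hs2.rpow_const fun p => Or.inl (hpos2 p).ne').inv₀ fun p => (Real.rpow_pos_of_pos (hpos2 p) _).ne'
  have hcr : Continuous fun p : ℝ × ℝ => cross (deriv Y p.2) (y p.1 - X p.2) :=
    (crossCLM.continuous.comp (hY'c.comp continuous_snd)).clm_apply hd2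
  have hF : Continuous (Function.uncurry fun τ σ => ((‖y τ - X σ‖ ^ 2 + m σ) ^ (3 / 2 : ℝ))⁻¹ • cross (deriv Y σ) (y τ - X σ)) :=
    hk32.smul hcr
  refine integrableOn_inner_integral_of_compact_support hYc.deriv hS hF (fun τ σ hσ => ?_) hφ
  show ((‖y τ - X σ‖ ^ 2 + m σ) ^ (3 / 2 : ℝ))⁻¹ • cross (deriv Y σ) (y τ - X σ) = 0
  rw [image_eq_zero_of_notMem_tsupport hσ, ← crossCLM_apply (0 : EuclideanSpace ℝ (Fin 3)), map_zero]
  simp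

end Summit.NavierStokesRegularity.NavierStokesRegularity.Theorems.Clause13RStationContinuity

end
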